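import Literature.Analysis.UnboundedOperators.HeatKernelFourier
import Literature.Analysis.FunctionSpaces.TorusMollifierEstimates
import Literature.Analysis.FunctionSpaces.TorusFourierSeries
import HarnessLib

/-!
# Heat smoothing of fields on the flat torus: `L^p` contraction, Fourier series, time FTC

Analysis/FunctionSpaces support file (all results proved; no definitions, no named facts). It
serves the discharge of the moment inequality for the spectral fractional Laplacian on `T^d`
(`Literature.Analysis.FluidPDE.Torus.fracLaplacian_moment_bound`, Pazy 1983, §2.6 Thm. 6.10, in
`FluidPDE/TorusLpOperatorFactsProofs`), whose proof runs through the heat semigroup.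

For a field `v : T^d → F` the **heat smoothing at time `s > 0`** is the torus function

  `x ↦ ∫_{ℝ^d} G_s(z) • v(x - proj z) dz`,   `G_s = heatKernel s` (Gauss–Weierstrass kernel),

i.e. the whole-space caloric extension `e^{sΔ}(v ∘ proj)` of the periodic lift
(`UnboundedOperators/HeatKernel`, `FluidPDE/TorusHeatFlow`) read back on the torus. The expression
is used literally (no new definition is introduced). We prove:

* `Torus.eLpNorm_heatSmoothing_le` — the `L^p` contraction `‖e^{sΔ}v‖_{L^p(T^d)} ≤ ‖v‖_{L^p(T^d)}`,
  `1 ≤ p < ∞` (Minkowski–Jensen against the probability density `G_s`, translation invariance of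
  Haar measure on `T^d`);
* `Torus.integral_heatKernel_mul_mFourier` — `∫ G_s(z) e_k(-proj z) dz = e^{-4π²s|k|²}`
  (the Fourier transform of the Gaussian at the lattice point `k`);
* `Torus.hasSum_heatSmoothing` — for a smooth real vector field `v`,
  `e^{sΔ}v(x) = ∑ₖ Re(e^{-4π²s|k|²} e_k(x) v̂(k))` (the absolutely convergent Fourier series of `v`
  integrated termwise against `G_s`), the joint continuity of `(x, s) ↦ e^{sΔ}v(x)` on `s > 0`,
  and `v(x) - e^{sΔ}v(x) = ∑ₖ Re((1 - e^{-4π²s|k|²}) e_k(x) v̂(k))`;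
* `Torus.sub_heatSmoothing_eq_neg_integral` — the time fundamental theorem
  `v - e^{sΔ}v = -∫₀ˢ e^{rΔ}(Δv) dr` (termwise integration, `𝓕(Δv)(k) = -4π²|k|² v̂(k)`), whence
* `Torus.eLpNorm_sub_heatSmoothing_le` — `‖v - e^{sΔ}v‖_{L^p} ≤ s ‖Δv‖_{L^p}`.

These are the two semigroup inputs (`‖e^{sΔ}‖ ≤ 1`, `‖(e^{sΔ} - 1)v‖ ≤ s‖Δv‖`) of the classical
proof of the moment inequality `‖A^α x‖ ≤ C‖x‖^{1-α}‖Ax‖^α` (Pazy 1983, §2.6, Thm. 6.10).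

## Mathlib / tree search

Mathlib: `hasSum_integral_of_dominated_convergence`, `integral_tsum`, `continuousOn_tsum`,
`eLpNorm_comp_measurePreserving`, `measurePreserving_sub_right`; no heat semigroup. Tree (all
reused, nothing redefined): `heatKernel`, `lintegral_enorm_heatKernel`,
`fourierIntegral_heatKernel_holds` (`UnboundedOperators/HeatKernel`, `HeatKernelFourier`);
`Literature.Analysis.FunctionSpaces.eLpNorm_integral_smul_le_mul` (Minkowski–Jensen, `TorusMollifierEstimates`);
`Torus.hasSum_realPart_mFourier_smul`, `Torus.summable_norm_mFourierCoeff_of_isSmooth`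
(`TorusFourierSeries`), `Torus.mFourierCoeff_complexify_laplacian` (`TorusFourierModes`),
`Torus.mFourier_apply_add` (`TorusFourierCalculus`). The tree's `FluidPDE/TorusHeatFlow` treats the
same flow as a function on `ℝ^d` (sup-norm bounds); the `L^p(T^d)` statements here are new
(`lean search 'heatKernel.*proj|eLpNorm.*heat.*Torus'`: nothing).

## References

* A. Pazy, *Semigroups of Linear Operators and Applications to PDE*, Springer 1983, §2.6
  (fractional powers; Thm. 6.10). [`Pazy1983`]
* L. Grafakos, *Classical Fourier Analysis*, 3rd ed. (2014), §3.1.1, Prop. 3.2.5 (inversion on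
  `𝕋ⁿ`). [`Grafakos2014`]
* L. C. Evans, *Partial Differential Equations*, 2nd ed. (2010), §2.3.1 (heat kernel). [`Evans2010`]
-/

noncomputable section

open MeasureTheory Set Filter Function UnitAddTorus Complex
open Literature.Analysis.UnboundedOperators
open scoped ENNReal NNReal ContDiff FourierTransform RealInnerProductSpace

namespace Literature.Analysis.FunctionSpaces

namespace Torus

variable {d : Type*} [Fintype d]

/-! ## `L^p` contraction of the heat smoothing -/

section Contraction

variable {F : Type*} [NormedAddCommGroup F] [NormedSpace ℝ F]

/-- **`L^p` contraction of the heat smoothing on the torus**: for continuous `v : T^d → F`,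
`s > 0` and `1 ≤ p < ∞`, `‖x ↦ ∫ G_s(z) v(x - proj z) dz‖_{L^p(T^d)} ≤ ‖v‖_{L^p(T^d)}`
(Minkowski–Jensen against the unit-mass kernel `G_s ≥ 0` and translation invariance of the Haar
measure of `T^d`; Pazy 1983, §2.6: `‖T(t)‖ ≤ 1` for the heat semigroup). [folklore] -/
theorem eLpNorm_heatSmoothing_le {v : UnitAddTorus d → F} (hv : Continuous v) {s : ℝ}
    (hs : 0 < s) {p : ℝ≥0∞} (hp : 1 ≤ p) (hp' : p ≠ ⊤) :
    eLpNorm (fun x => ∫ z : EuclideanSpace ℝ d, heatKernel s z • v (x - proj z)) p volume ≤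
      eLpNorm v p volume := by
  have hk : AEStronglyMeasurable (heatKernel (E := EuclideanSpace ℝ d) s) volume :=
    (continuous_heatKernel s).aestronglyMeasurable
  have hΦ : AEStronglyMeasurable
      (uncurry fun (x : UnitAddTorus d) (z : EuclideanSpace ℝ d) => v (x - proj z))
      ((volume : Measure (UnitAddTorus d)).prod volume) :=
    (hv.comp (continuous_fst.sub (continuous_proj.comp continuous_snd))).aestronglyMeasurable
  have hA : ∀ᵐ z ∂(volume : Measure (EuclideanSpace ℝ d)), heatKernel s z ≠ 0 →
      eLpNorm (fun x => v (x - proj z)) p volume ≤ eLpNorm v p volume := by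
    refine Eventually.of_forall fun z _ => le_of_eq ?_
    exact eLpNorm_comp_measurePreserving (p := p) hv.aestronglyMeasurable
      (measurePreserving_sub_right (volume : Measure (UnitAddTorus d)) (proj z))
  calc eLpNorm (fun x => ∫ z : EuclideanSpace ℝ d, heatKernel s z • v (x - proj z)) p volume
      ≤ (∫⁻ z, ‖heatKernel (E := EuclideanSpace ℝ d) s z‖ₑ) * eLpNorm v p volume :=
        eLpNorm_integral_smul_le_mul hk hΦ hp hp' hA
    _ = eLpNorm v p volume := by rw [lintegral_enorm_heatKernel hs, one_mul]

end Contraction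

/-! ## The Gaussian against the characters of the torus -/

section Character

variable [DecidableEq d]

/-- `⟪z, latticeVec k⟫ = ∑ᵢ zᵢ kᵢ`. [folklore] -/
theorem inner_latticeVec_right (z : EuclideanSpace ℝ d) (k : d → ℤ) :
    ⟪z, latticeVec k⟫ = ∑ i, z i * (k i : ℝ) := by
  simp [PiLp.inner_apply, latticeVec_apply, mul_comm]

/-- The lifted character: `e_k(proj y) = 𝐞(⟪y, latticeVec k⟫) = exp(2πi ∑ᵢ kᵢ yᵢ)`
(Grafakos 2014, §3.1.1; twin of `ScalarFourier.mFourier_proj` in `FluidPDE/`, not importable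
here). [folklore] -/
theorem mFourier_proj_eq_fourierChar (k : d → ℤ) (y : EuclideanSpace ℝ d) :
    mFourier k (proj y) = (𝐞 (⟪y, latticeVec k⟫) : ℂ) := by
  simp only [mFourier, ContinuousMap.coe_mk, proj_apply, fourier_coe_apply,
    Real.fourierChar_apply, ← Complex.exp_sum, inner_latticeVec_right]
  congr 1
  push_cast
  rw [Finset.mul_sum, Finset.sum_mul]
  refine Finset.sum_congr rfl fun i _ => ?_
  ring

/-- `‖latticeVec k‖² = |k|²` (`= Torus.freqNormSq k`). [folklore] -/
theorem norm_latticeVec_sq (k : d → ℤ) : ‖latticeVec k‖ ^ 2 = freqNormSq k := by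
  rw [EuclideanSpace.norm_sq_eq, freqNormSq]
  refine Finset.sum_congr rfl fun i _ => ?_
  rw [latticeVec_apply, Real.norm_eq_abs, sq_abs]

/-- **The Gaussian against a character**: `∫_{ℝ^d} G_s(z) e_k(-proj z) dz = e^{-4π²s|k|²}`
(`s > 0`), the Fourier transform of the heat kernel (`fourierIntegral_heatKernel_holds`:
`𝓕 G_s(ξ) = e^{-(2π)²s‖ξ‖²}`) at the lattice point `ξ = latticeVec k`. [folklore] -/
theorem integral_heatKernel_mul_mFourier {s : ℝ} (hs : 0 < s) (k : d → ℤ) :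
    ∫ z : EuclideanSpace ℝ d, (heatKernel s z : ℂ) * mFourier k (-proj z) =
      (Real.exp (-(s * (4 * Real.pi ^ 2 * freqNormSq k))) : ℂ) := by
  have hF := fourierIntegral_heatKernel_holds (E := EuclideanSpace ℝ d) hs (latticeVec k)
  rw [Real.fourier_eq] at hF
  have hfun : (fun z : EuclideanSpace ℝ d => 𝐞 (-⟪z, latticeVec k⟫) • (heatKernel s z : ℂ)) =
      fun z => (heatKernel s z : ℂ) * mFourier k (-proj z) := by
    funext z
    rw [Circle.smul_def, smul_eq_mul, mul_comm, ← proj_neg, mFourier_proj_eq_fourierChar,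
      inner_neg_left]
  rw [hfun] at hF
  rw [hF, heatSymbol, norm_latticeVec_sq]
  push_cast
  congr 1
  ring

end Character

/-! ## Fourier series of the heat smoothing of a smooth real vector field -/

section Series

variable [DecidableEq d]

omit [DecidableEq d] in
/-- Algebra of the modes: `G • (e_k(x - proj z) • c) = (G e_k(-proj z)) • (e_k(x) • c)`. [folklore] -/
theorem heatKernel_smul_mFourier_sub_smul (G : ℝ) (k : d → ℤ) (x : UnitAddTorus d)
    (z : EuclideanSpace ℝ d) (c : EuclideanSpace ℂ d) :
    (G : ℝ) • (mFourier k (x - proj z) • c) =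
      ((G : ℂ) * mFourier k (-proj z)) • (mFourier k x • c) := by
  rw [sub_eq_add_neg, mFourier_apply_add, ← Complex.coe_smul, smul_smul, smul_smul]
  congr 1
  ring

/-- **Fourier series of the heat smoothing.** For a smooth real vector field `v` on `T^d`,
`s > 0` and `x ∈ T^d`,
`∫ G_s(z) v(x - proj z) dz = ∑ₖ Re (e^{-4π²s|k|²} e_k(x) v̂(k))` (absolutely convergent):
the pointwise Fourier series of `v` (`hasSum_realPart_mFourier_smul`) integrated termwise against
the probability density `G_s` (dominated convergence), and `∫ G_s(z) e_k(-proj z) dz = e^{-4π²s|k|²}`.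
This identifies the heat smoothing with the Fourier multiplier `e^{sΔ}` (Grafakos 2014, §3.1;
Pazy 1983, §2.6). [folklore] -/
theorem hasSum_heatSmoothing {v : UnitAddTorus d → EuclideanSpace ℝ d} (hv : IsSmooth v) {s : ℝ}
    (hs : 0 < s) (x : UnitAddTorus d) :
    HasSum (fun k : d → ℤ => EuclideanSpace.realPart
        (Real.exp (-(s * (4 * Real.pi ^ 2 * freqNormSq k))) •
          (mFourier k x • mFourierCoeff (EuclideanSpace.complexify ∘ v) k)))
      (∫ z : EuclideanSpace ℝ d, heatKernel s z • v (x - proj z)) := by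
  set c : (d → ℤ) → EuclideanSpace ℂ d := mFourierCoeff (EuclideanSpace.complexify ∘ v) with hc
  have hsum : Summable fun k => ‖c k‖ := summable_norm_mFourierCoeff_of_isSmooth hv
  have hG0 : ∀ z : EuclideanSpace ℝ d, 0 ≤ heatKernel s z := fun z => (heatKernel_pos hs z).le
  -- termwise integrands and their integrals
  set T : (d → ℤ) → EuclideanSpace ℝ d → EuclideanSpace ℝ d := fun k z =>
    heatKernel s z • EuclideanSpace.realPart (mFourier k (x - proj z) • c k) with hT
  have hlim : ∀ z : EuclideanSpace ℝ d, HasSum (fun k => T k z) (heatKernel s z • v (x - proj z)) :=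
    fun z => (hasSum_realPart_mFourier_smul hv (x - proj z)).const_smul _
  have hmeas : ∀ k, AEStronglyMeasurable (T k) (volume : Measure (EuclideanSpace ℝ d)) := by
    intro k
    refine Continuous.aestronglyMeasurable ?_
    exact (continuous_heatKernel s).smul (EuclideanSpace.realPart.continuous.comp
      (((mFourier k).continuous.comp (continuous_const.sub continuous_proj)).smul continuous_const))
  have hbound : ∀ k, ∀ᵐ z ∂(volume : Measure (EuclideanSpace ℝ d)), ‖T k z‖ ≤ heatKernel s z * ‖c k‖ := by
    intro k
    refine Eventually.of_forall fun z => ?_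
    rw [hT, norm_smul, Real.norm_of_nonneg (hG0 z)]
    exact mul_le_mul_of_nonneg_left (norm_realPart_mFourier_smul_le k _ _) (hG0 z)
  have hint : Integrable (fun z : EuclideanSpace ℝ d => ∑' k, heatKernel s z * ‖c k‖) volume := by
    have : (fun z : EuclideanSpace ℝ d => ∑' k, heatKernel s z * ‖c k‖) =
        fun z => heatKernel s z * ∑' k, ‖c k‖ := funext fun z => tsum_mul_left
    rw [this]
    exact (integrable_heatKernel_holds hs).mul_const _
  have h := hasSum_integral_of_dominated_convergence (fun k z => heatKernel s z * ‖c k‖) hmeas hbound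
    (Eventually.of_forall fun z => hsum.mul_left _) hint (Eventually.of_forall hlim)
  -- the value of each termwise integral
  have hterm : ∀ k, ∫ z, T k z = EuclideanSpace.realPart
      (Real.exp (-(s * (4 * Real.pi ^ 2 * freqNormSq k))) • (mFourier k x • c k)) := by
    intro k
    have hTk : T k = fun z => EuclideanSpace.realPart
        (((heatKernel s z : ℂ) * mFourier k (-proj z)) • (mFourier k x • c k)) := by
      funext z
      rw [hT]
      dsimp only
      rw [← map_smul, heatKernel_smul_mFourier_sub_smul]
    have hgi : Integrable (fun z : EuclideanSpace ℝ d => (heatKernel s z : ℂ) * mFourier k (-proj z))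
        volume :=
      (integrable_heatKernel_holds hs).ofReal.mul_bdd
        ((mFourier k).continuous.comp (continuous_proj.neg)).aestronglyMeasurable
          (c := 1) (Eventually.of_forall fun z =>
            ((mFourier k).norm_coe_le_norm (-proj z)).trans_eq mFourier_norm)
    rw [hTk, ContinuousLinearMap.integral_comp_comm _ (hgi.smul_const _), integral_smul_const,
      integral_heatKernel_mul_mFourier hs k, Complex.coe_smul]
  have hfun : (fun k => ∫ z, T k z) = fun k => EuclideanSpace.realPart
      (Real.exp (-(s * (4 * Real.pi ^ 2 * freqNormSq k))) • (mFourier k x • c k)) :=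
    funext hterm
  rw [hfun] at h
  exact h

omit [DecidableEq d] in
/-- Each heat mode is bounded by its coefficient for `s ≥ 0`:
`‖Re(e^{-4π²s|k|²} e_k(x) c)‖ ≤ ‖c‖`. [folklore] -/
theorem norm_realPart_heatMode_le {s : ℝ} (hs : 0 ≤ s) (k : d → ℤ) (x : UnitAddTorus d)
    (c : EuclideanSpace ℂ d) :
    ‖EuclideanSpace.realPart (Real.exp (-(s * (4 * Real.pi ^ 2 * freqNormSq k))) • (mFourier k x • c))‖ ≤
      ‖c‖ := by
  rw [map_smul, norm_smul, Real.norm_of_nonneg (Real.exp_nonneg _)]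
  have h1 : Real.exp (-(s * (4 * Real.pi ^ 2 * freqNormSq k))) ≤ 1 := by
    rw [Real.exp_le_one_iff, neg_nonpos]
    exact mul_nonneg hs (by have := freqNormSq_nonneg k; positivity)
  calc Real.exp (-(s * (4 * Real.pi ^ 2 * freqNormSq k))) * ‖EuclideanSpace.realPart (mFourier k x • c)‖
      ≤ 1 * ‖c‖ := mul_le_mul h1 (norm_realPart_mFourier_smul_le k x c) (norm_nonneg _) zero_le_one
    _ = ‖c‖ := one_mul _

/-- **Joint continuity of the heat series** `(x, s) ↦ ∑ₖ Re(e^{-4π²s|k|²} e_k(x) v̂(k))` on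
`T^d × [0, ∞)` (uniform convergence, dominated by `∑ₖ ‖v̂(k)‖`). [folklore] -/
theorem continuousOn_heatSeries {v : UnitAddTorus d → EuclideanSpace ℝ d} (hv : IsSmooth v) :
    ContinuousOn (fun q : UnitAddTorus d × ℝ => ∑' k : d → ℤ, EuclideanSpace.realPart
      (Real.exp (-(q.2 * (4 * Real.pi ^ 2 * freqNormSq k))) •
        (mFourier k q.1 • mFourierCoeff (EuclideanSpace.complexify ∘ v) k))) (univ ×ˢ Ici 0) := by
  refine continuousOn_tsum (fun k => Continuous.continuousOn ?_)
    (summable_norm_mFourierCoeff_of_isSmooth hv) (fun k q hq => norm_realPart_heatMode_le hq.2 k q.1 _)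
  exact EuclideanSpace.realPart.continuous.comp
    ((Real.continuous_exp.comp ((continuous_snd.mul continuous_const).neg)).smul
      (((mFourier k).continuous.comp continuous_fst).smul continuous_const))

/-- **Joint continuity of the heat smoothing** `(x, s) ↦ ∫ G_s(z) v(x - proj z) dz` on
`T^d × (0, ∞)` for a smooth real vector field `v`. [folklore] -/
theorem continuousOn_heatSmoothing {v : UnitAddTorus d → EuclideanSpace ℝ d} (hv : IsSmooth v) :
    ContinuousOn (fun q : UnitAddTorus d × ℝ =>
      ∫ z : EuclideanSpace ℝ d, heatKernel q.2 z • v (q.1 - proj z)) (univ ×ˢ Ioi 0) := by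
  refine ((continuousOn_heatSeries hv).mono (prod_mono le_rfl Ioi_subset_Ici_self)).congr
    fun q hq => ?_
  exact ((hasSum_heatSmoothing hv (s := q.2) hq.2 q.1).tsum_eq).symm

/-- For fixed `s > 0` the heat smoothing of a smooth real vector field is continuous on `T^d`.
[folklore] -/
theorem continuous_heatSmoothing {v : UnitAddTorus d → EuclideanSpace ℝ d} (hv : IsSmooth v)
    {s : ℝ} (hs : 0 < s) :
    Continuous fun x : UnitAddTorus d =>
      ∫ z : EuclideanSpace ℝ d, heatKernel s z • v (x - proj z) := by
  have h := (continuousOn_heatSmoothing hv).comp_continuous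
    (continuous_id.prodMk continuous_const : Continuous fun x : UnitAddTorus d => (x, s))
    fun x => ⟨mem_univ _, hs⟩
  exact h

/-- **The smoothing error in Fourier variables**: for `s > 0`,
`v(x) - ∫ G_s(z) v(x - proj z) dz = ∑ₖ Re((1 - e^{-4π²s|k|²}) e_k(x) v̂(k))`. [folklore] -/
theorem hasSum_sub_heatSmoothing {v : UnitAddTorus d → EuclideanSpace ℝ d} (hv : IsSmooth v)
    {s : ℝ} (hs : 0 < s) (x : UnitAddTorus d) :
    HasSum (fun k : d → ℤ => EuclideanSpace.realPart
        ((1 - Real.exp (-(s * (4 * Real.pi ^ 2 * freqNormSq k)))) •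
          (mFourier k x • mFourierCoeff (EuclideanSpace.complexify ∘ v) k)))
      (v x - ∫ z : EuclideanSpace ℝ d, heatKernel s z • v (x - proj z)) := by
  have h := (hasSum_realPart_mFourier_smul hv x).sub (hasSum_heatSmoothing hv hs x)
  refine h.congr_fun fun k => ?_
  rw [sub_smul, one_smul, map_sub]

end Series

/-! ## The time fundamental theorem `v - e^{sΔ}v = -∫₀ˢ e^{rΔ}Δv dr` and its `L^p` form -/

section TimeFTC

variable [DecidableEq d]

omit [Fintype d] [DecidableEq d] in
/-- `∫₀ˢ λ e^{-rλ} dr = 1 - e^{-sλ}` for `0 ≤ s` (any real `λ`). [folklore] -/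
theorem integral_mul_exp_neg_mul_Ioc (l : ℝ) {s : ℝ} (hs : 0 ≤ s) :
    ∫ r in Ioc 0 s, l * Real.exp (-(r * l)) = 1 - Real.exp (-(s * l)) := by
  rw [← intervalIntegral.integral_of_le hs]
  have hderiv : ∀ r ∈ uIcc 0 s, HasDerivAt (fun r => -Real.exp (-(r * l))) (l * Real.exp (-(r * l))) r := by
    intro r _
    have h1 : HasDerivAt (fun r : ℝ => -(r * l)) (-l) r := (hasDerivAt_mul_const l).fun_neg
    exact h1.exp.fun_neg.congr_deriv (by ring)
  rw [intervalIntegral.integral_eq_sub_of_hasDerivAt hderiv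
    ((continuous_const.mul (Real.continuous_exp.comp
      ((continuous_id.mul continuous_const).neg))).intervalIntegrable _ _)]
  simp only [zero_mul, neg_zero, Real.exp_zero]
  ring

omit [DecidableEq d] in
/-- Algebra of the Laplacian modes: `Re(a • (e • (-(λ • c)))) = -Re((λa) • (e • c))` (`a, λ` real,
`e` complex). [folklore] -/
theorem realPart_heatMode_neg_smul (a l : ℝ) (e : ℂ) (c : EuclideanSpace ℂ d) :
    EuclideanSpace.realPart (a • (e • -(((l : ℝ) : ℂ) • c))) =
      -EuclideanSpace.realPart ((l * a) • (e • c)) := by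
  rw [smul_neg, smul_neg, map_neg, smul_comm e ((l : ℝ) : ℂ) c, Complex.coe_smul, smul_smul,
    mul_comm a l]

/-- **Time fundamental theorem for the heat smoothing** of a smooth real vector field: for
`s > 0`, `v(x) - ∫ G_s(z) v(x - proj z) dz = -∫₀ˢ (∫ G_r(z) (Δv)(x - proj z) dz) dr`, i.e.
`v - e^{sΔ}v = -∫₀ˢ e^{rΔ} Δv dr` (termwise integration of the Fourier series,
`𝓕(Δv)(k) = -4π²|k|² v̂(k)` and `∫₀ˢ λ e^{-rλ} dr = 1 - e^{-sλ}`; Pazy 1983, §1.2 Thm. 2.4 (d) (2.6) for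
the heat semigroup). [folklore] -/
theorem sub_heatSmoothing_eq_neg_integral {v : UnitAddTorus d → EuclideanSpace ℝ d}
    (hv : IsSmooth v) {s : ℝ} (hs : 0 < s) (x : UnitAddTorus d) :
    v x - ∫ z : EuclideanSpace ℝ d, heatKernel s z • v (x - proj z) =
      -∫ r in Ioc 0 s, ∫ z : EuclideanSpace ℝ d, heatKernel r z • laplacian v (x - proj z) := by
  set c : (d → ℤ) → EuclideanSpace ℂ d := mFourierCoeff (EuclideanSpace.complexify ∘ v) with hc
  have hlam0 : ∀ k : d → ℤ, 0 ≤ 4 * Real.pi ^ 2 * freqNormSq k := fun k => by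
    have := freqNormSq_nonneg k; positivity
  have hsum : Summable fun k => ‖c k‖ := summable_norm_mFourierCoeff_of_isSmooth hv
  -- the termwise integrands in `r`
  set f : (d → ℤ) → ℝ → EuclideanSpace ℝ d := fun k r =>
    -EuclideanSpace.realPart ((4 * Real.pi ^ 2 * freqNormSq k * Real.exp (-(r * (4 * Real.pi ^ 2 * freqNormSq k)))) •
      (mFourier k x • c k)) with hf
  -- (1) the inner heat smoothing of `Δv` is the series `∑ f k r` for `r > 0`
  have hinner : ∀ r, 0 < r → ∫ z : EuclideanSpace ℝ d, heatKernel r z • laplacian v (x - proj z) =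
      ∑' k, f k r := by
    intro r hr
    rw [← (hasSum_heatSmoothing hv.laplacian hr x).tsum_eq]
    refine tsum_congr fun k => ?_
    rw [hf]
    dsimp only
    rw [mFourierCoeff_complexify_laplacian hv k, ← hc]
    exact realPart_heatMode_neg_smul _ _ _ _
  -- (2) termwise integrability bounds
  have hmeas : ∀ k, AEStronglyMeasurable (f k) (volume.restrict (Ioc 0 s)) := by
    intro k
    refine Continuous.aestronglyMeasurable ?_
    exact (EuclideanSpace.realPart.continuous.comp ((continuous_const.mul
      (Real.continuous_exp.comp ((continuous_id.mul continuous_const).neg))).smul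
        continuous_const)).neg
  have hnorm : ∀ k r, ‖f k r‖ ≤ 4 * Real.pi ^ 2 * freqNormSq k * Real.exp (-(r * (4 * Real.pi ^ 2 * freqNormSq k))) * ‖c k‖ := by
    intro k r
    rw [hf]
    dsimp only
    rw [norm_neg, map_smul, norm_smul, Real.norm_of_nonneg (mul_nonneg (hlam0 k) (Real.exp_nonneg _))]
    exact mul_le_mul_of_nonneg_left (norm_realPart_mFourier_smul_le k x _)
      (mul_nonneg (hlam0 k) (Real.exp_nonneg _))
  have hlint : ∀ k, ∫⁻ r in Ioc 0 s, ‖f k r‖ₑ ≤ ENNReal.ofReal ‖c k‖ := by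
    intro k
    have hgi : Integrable (fun r => 4 * Real.pi ^ 2 * freqNormSq k *
        Real.exp (-(r * (4 * Real.pi ^ 2 * freqNormSq k))) * ‖c k‖)
        (volume.restrict (Ioc 0 s)) :=
      ((continuous_const.mul (Real.continuous_exp.comp
        ((continuous_id.mul continuous_const).neg))).mul continuous_const).integrableOn_Ioc
    calc ∫⁻ r in Ioc 0 s, ‖f k r‖ₑ
        ≤ ∫⁻ r in Ioc 0 s, ENNReal.ofReal (4 * Real.pi ^ 2 * freqNormSq k *
            Real.exp (-(r * (4 * Real.pi ^ 2 * freqNormSq k))) * ‖c k‖) := by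
          refine lintegral_mono fun r => ?_
          rw [← ofReal_norm]
          exact ENNReal.ofReal_le_ofReal (hnorm k r)
      _ = ENNReal.ofReal (∫ r in Ioc 0 s, 4 * Real.pi ^ 2 * freqNormSq k *
            Real.exp (-(r * (4 * Real.pi ^ 2 * freqNormSq k))) * ‖c k‖) := by
          rw [ofReal_integral_eq_lintegral_ofReal hgi]
          exact Eventually.of_forall fun r =>
            mul_nonneg (mul_nonneg (hlam0 k) (Real.exp_nonneg _)) (norm_nonneg _)
      _ = ENNReal.ofReal ((1 - Real.exp (-(s * (4 * Real.pi ^ 2 * freqNormSq k)))) * ‖c k‖) := by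
          rw [integral_mul_const, integral_mul_exp_neg_mul_Ioc _ hs.le]
      _ ≤ ENNReal.ofReal ‖c k‖ := by
          refine ENNReal.ofReal_le_ofReal ?_
          have : 0 ≤ Real.exp (-(s * (4 * Real.pi ^ 2 * freqNormSq k))) := Real.exp_nonneg _
          nlinarith [norm_nonneg (c k)]
  have htsum : ∑' k, ∫⁻ r in Ioc 0 s, ‖f k r‖ₑ ≠ ⊤ := by
    refine ne_top_of_le_ne_top (ENNReal.ofReal_ne_top (r := ∑' k, ‖c k‖)) ?_
    rw [ENNReal.ofReal_tsum_of_nonneg (fun k => norm_nonneg _) hsum]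
    exact ENNReal.tsum_le_tsum hlint
  -- (3) termwise integrals
  have hterm : ∀ k, ∫ r in Ioc 0 s, f k r =
      -EuclideanSpace.realPart ((1 - Real.exp (-(s * (4 * Real.pi ^ 2 * freqNormSq k)))) •
        (mFourier k x • c k)) := by
    intro k
    rw [hf]
    dsimp only
    rw [integral_neg, ContinuousLinearMap.integral_comp_comm _ ?_, integral_smul_const,
      integral_mul_exp_neg_mul_Ioc _ hs.le]
    exact ((continuous_const.mul (Real.continuous_exp.comp
      ((continuous_id.mul continuous_const).neg))).integrableOn_Ioc).smul_const _
  -- (4) assemble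
  rw [setIntegral_congr_fun measurableSet_Ioc (fun r hr => hinner r hr.1), integral_tsum hmeas htsum]
  simp_rw [hterm]
  rw [tsum_neg, neg_neg]
  exact ((hasSum_sub_heatSmoothing hv hs x).tsum_eq).symm

/-- **`L^p` form of the time fundamental theorem**: for a smooth real vector field `v` on `T^d`,
`s > 0` and `1 ≤ p < ∞`, `‖v - e^{sΔ}v‖_{L^p(T^d)} ≤ s ‖Δv‖_{L^p(T^d)}` (Minkowski–Jensen in the
time variable and the `L^p` contraction; Pazy 1983, §1.2 Thm. 2.4 (d) (2.6) with `‖T(t)‖ ≤ 1`).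
[folklore] -/
theorem eLpNorm_sub_heatSmoothing_le {v : UnitAddTorus d → EuclideanSpace ℝ d} (hv : IsSmooth v)
    {s : ℝ} (hs : 0 < s) {p : ℝ≥0∞} (hp : 1 ≤ p) (hp' : p ≠ ⊤) :
    eLpNorm (fun x => v x - ∫ z : EuclideanSpace ℝ d, heatKernel s z • v (x - proj z)) p volume ≤
      ENNReal.ofReal s * eLpNorm (laplacian v) p volume := by
  set Φ : UnitAddTorus d → ℝ → EuclideanSpace ℝ d := fun x r =>
    ∫ z : EuclideanSpace ℝ d, heatKernel r z • laplacian v (x - proj z) with hΦ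
  have hfun : (fun x => v x - ∫ z : EuclideanSpace ℝ d, heatKernel s z • v (x - proj z)) =
      -fun x => ∫ r in Ioc 0 s, (1 : ℝ) • Φ x r := by
    funext x
    rw [sub_heatSmoothing_eq_neg_integral hv hs x, Pi.neg_apply]
    simp only [one_smul, hΦ]
  rw [hfun, eLpNorm_neg]
  -- joint measurability on `T^d × (0, s]`
  have hmeasΦ : AEStronglyMeasurable (uncurry Φ)
      ((volume : Measure (UnitAddTorus d)).prod (volume.restrict (Ioc 0 s))) := by
    have hcont : ContinuousOn (uncurry Φ) (univ ×ˢ Ioc 0 s) :=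
      (continuousOn_heatSmoothing hv.laplacian).mono (prod_mono le_rfl Ioc_subset_Ioi_self)
    have hμ : (volume : Measure (UnitAddTorus d)).prod (volume.restrict (Ioc 0 s)) =
        ((volume : Measure (UnitAddTorus d)).prod volume).restrict (univ ×ˢ Ioc 0 s) := by
      rw [← Measure.prod_restrict, Measure.restrict_univ]
    rw [hμ]
    exact hcont.aestronglyMeasurable (MeasurableSet.univ.prod measurableSet_Ioc)
  have hA : ∀ᵐ r ∂(volume.restrict (Ioc 0 s)), (1 : ℝ) ≠ 0 →
      eLpNorm (fun x => Φ x r) p volume ≤ eLpNorm (laplacian v) p volume := by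
    filter_upwards [ae_restrict_mem measurableSet_Ioc] with r hr _
    exact eLpNorm_heatSmoothing_le hv.laplacian.continuous hr.1 hp hp'
  calc eLpNorm (fun x => ∫ r in Ioc 0 s, (1 : ℝ) • Φ x r) p volume
      ≤ (∫⁻ _r in Ioc 0 s, ‖(1 : ℝ)‖ₑ) * eLpNorm (laplacian v) p volume :=
        eLpNorm_integral_smul_le_mul aestronglyMeasurable_const hmeasΦ hp hp' hA
    _ = ENNReal.ofReal s * eLpNorm (laplacian v) p volume := by
        rw [enorm_one, lintegral_one, Measure.restrict_apply_univ, Real.volume_Ioc, sub_zero]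

end TimeFTC

end Torus

end Literature.Analysis.FunctionSpaces
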